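import Literature.InformationTheory.QuantumLearning.PauliChannelEstimation
import Mathlib.Analysis.Matrix.Order
import HarnessLib

/-!
# Two-copy Bell sampling: the Bell basis diagonalises `P ⊗ P`, and `|Tr(Pρ)|²` for every Pauli
string from one Bell-measurement distribution

Topic `Literature/InformationTheory/QuantumLearning` (next to `PauliChannelEstimation.lean`, whose
doubled register `(ι → Bool) × (ι → Bool)`, Bell state `bellState = Φ⁺` and Bell basis
`bellBasis b = (P_b ⊗ 1)Φ⁺(P_b ⊗ 1)` are reused verbatim).  The statement behind "Bell measurements
on two copies of `ρ`" in the learning-from-experiments literature, as printed by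
Huang–Kueng–Preskill, *Information-theoretic bounds on quantum advantage in machine learning*,
Phys. Rev. Lett. **126**, 190505 (2021), Supplementary Material, section *Exponential separation
for predicting expectation values of Pauli operators* ▸ *Measuring absolute values*, and, word for
word, by Huang et al., *Quantum advantage in learning from experiments*, Science **376**, 1182
(2022), Supplementary Material, section *Predicting highly-incompatible observables* ▸ *A constant
upper bound for quantum-enhanced experiments* ▸ *Prediction phase*:

"first consider the case where `ρ` is the density operator of a single qubit, and suppose that
`ρ ⊗ ρ` is measured in the Bell basis. The outcome `S` is the projector onto one of the four Bell
states … If `σ ∈ {I, X, Y, Z}` is any Pauli matrix, then each Bell state is an eigenstate of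
`σ ⊗ σ` with eigenvalue `±1`. In the state `S`, the `+1` eigenvalue of `σ ⊗ σ` occurs with
probability `Prob(+) = ½Tr((I⊗I + σ⊗σ)(ρ⊗ρ))`, and the `−1` eigenvalue occurs with probability
`Prob(−) = ½Tr((I⊗I − σ⊗σ)(ρ⊗ρ))`. Therefore
`E[Tr((σ⊗σ)S)] = Prob(+) − Prob(−) = Tr((σ⊗σ)(ρ⊗ρ)) = |Tr(σρ)|²` …  If
`P = σ_1 ⊗ … ⊗ σ_n` is a Pauli observable, then `S_k` is an eigenstate of `σ_k ⊗ σ_k` with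
eigenvalue `±1` for each `k` … `∏_k Tr((σ_k⊗σ_k)S_k) = ±1` … Therefore
`E[∏_k Tr((σ_k⊗σ_k)S_k)] = E[Tr((P⊗P) ⊗_k S_k)] = Prob(P⊗P = +1) − Prob(P⊗P = −1)
 = Tr((P⊗P)(ρ⊗ρ)) = |Tr(Pρ)|²`" [cite: HuangKuengPreskill2021, SM §'Exponential separation for
predicting expectation values of Pauli operators' ▸ 'Measuring absolute values']
[cite: HuangEtAl2022Science, SM §'A constant upper bound for quantum-enhanced experiments' ▸
'Prediction phase', eq. (bell-expected)]; and the outcome distribution itself, Montanaro,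
*Learning stabilizer states by Bell sampling* (2017), Lemma 2: "Let `|ψ⟩` be a state of `n`
qubits. Bell sampling on `|ψ⟩^{⊗2}` returns outcome `r` with probability `|⟨ψ|σ_r|ψ*⟩|²/2ⁿ`",
`|ψ*⟩` the complex conjugate in the computational basis [cite: Montanaro2017BellSampling, Lemma 2].

## Contents (all proved, 0 named facts)

* Transposition of Pauli strings: `transpose_pauliMat` (`Xᵀ = X`, `Zᵀ = Z`, `Iᵀ = I`, `Yᵀ = −Y`),
  `ySign S = (−1)^{#{i : S_i = Y}}`, **`transpose_pauliString`** (`P_Sᵀ = ySign S • P_S`).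
* The ricochet (transpose trick) on the tree's Bell state, **`kronecker_one_mul_bellState`**:
  `(A ⊗ 1)Φ⁺ = (1 ⊗ Aᵀ)Φ⁺` [cite: BengtssonZyczkowski2017, eq. (16.20)–(16.21)], and the
  read-out of product operators **`trace_bellState_mul_kronecker`**: `Tr(Φ⁺(A ⊗ B)) = 2^{−n}Tr(ABᵀ)`.
* **Montanaro's Lemma 2 in density-matrix form**, `trace_bellBasis_mul_kronecker`:
  `Tr(Φ_b(ρ ⊗ σ)) = 2^{−n} Tr(P_b ρ P_b σᵀ)` for all operators `ρ, σ` on the register (for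
  `ρ = σ = |ψ⟩⟨ψ|` this is the printed `|⟨ψ|P_b|ψ*⟩|²/2ⁿ`: **`trace_bellBasis_mul_kronecker_pure`**),
  and `sum_trace_bellBasis_mul` (the outcome weights sum to `Tr ρ · Tr σ`).
* **"Each Bell state is an eigenstate of `σ ⊗ σ` with eigenvalue `±1`"**, with the sign made
  explicit: `kronecker_self_mul_bellState` (`(P_a ⊗ P_a)Φ⁺ = ySign a • Φ⁺`),
  **`kronecker_self_mul_bellBasis`** (`(P_a ⊗ P_a)Φ_b = ε(a,b) • Φ_b`,
  `ε(a,b) = ySign a · (−1)^{⟨a,b⟩}` with the tree's commutation character `strSign`),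
  `trace_kronecker_self_mul_bellBasis` (`Tr((P_a⊗P_a)Φ_b) = ε(a,b)`, the printed `±1`),
  **`kronecker_self_eq_sum_bellBasis`** (the spectral decomposition `P_a ⊗ P_a = Σ_b ε(a,b) Φ_b`).
* **The printed identity (bell-expected)**: `sum_bellSign_mul_trace_bellBasis_mul`
  (`Σ_b ε(a,b)·Tr(Φ_b X) = Tr((P_a⊗P_a)X)` for every operator `X` on the doubled register — the
  expectation of the `±1`-valued statistic under the Bell-measurement distribution `Tr(Φ_b X)`),
  `trace_kronecker_self_mul_kronecker` (`Tr((P_a⊗P_a)(ρ⊗σ)) = Tr(P_aρ)Tr(P_aσ)`),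
  **`sum_bellSign_mul_trace_bellBasis_two_copies`** (`Σ_b ε(a,b) Tr(Φ_b(ρ⊗ρ)) = Tr(P_aρ)²`) and
  `…_eq_norm_sq` (`= |Tr(P_aρ)|²` for Hermitian `ρ`), together with the two half-sums
  `sum_trace_bellBasis_mul_filter_sign_eq` (`Prob(±) = ½Tr((1 ± P_a⊗P_a)X)`).

* (v2) **The printed per-qubit product form and the one-qubit table**: `bellSign₁ σ τ` (the `±1`
  eigenvalue of `σ ⊗ σ` on the one-qubit Bell projector `Φ_τ`), `bellSign_eq_prod`
  (`ε(a,b) = ∏_k bellSign₁ (a_k) (b_k)` — the printed `∏_k Tr((σ_k⊗σ_k)S_k)`),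
  `trace_kronecker_self_mul_bellBasis_eq_prod`, **`bellSign₁_table`** (for the four Bell states
  `|Ψ⁺⟩ = |Ω⟩, |Ψ⁻⟩ = (I⊗Z)|Ω⟩, |Φ⁺⟩ = (I⊗X)|Ω⟩, |Φ⁻⟩ = i(I⊗Y)|Ω⟩` of [HuangKuengPreskill2021] —
  whose projectors are the tree's `Φ_I, Φ_Z, Φ_X, Φ_Y` by the ricochet identity — the eigenvalue
  triples `(X⊗X, Y⊗Y, Z⊗Z) = (+,−,+), (−,+,+), (+,+,−), (−,−,−)`).
* (v2) **The outcome law is a probability distribution**: `bellVec` / `bellState_eq_vecMulVec`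
  (`Φ⁺ = |Ω⟩⟨Ω|`, `|Ω⟩ = 2^{−n/2}Σ_j|j⟩|j⟩`), `bellBasis_eq_vecMulVec` (`Φ_b = |Φ_b⟩⟨Φ_b|`,
  `|Φ_b⟩ = (P_b ⊗ 1)|Ω⟩`), `trace_vecMulVec_mul` (`Tr(|v⟩⟨w̄| X) = ⟨w̄|X|v⟩`),
  **`trace_bellBasis_mul_nonneg`** (`Tr(Φ_b X) ≥ 0` for `X ⪰ 0`) and
  `trace_bellBasis_mul_kronecker_nonneg` (`ρ, σ ⪰ 0`); with `sum_trace_bellBasis_mul_kronecker`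
  the weights `Tr(Φ_b(ρ ⊗ σ))` of two states form a probability distribution on the `4ⁿ` labels.

Not covered (scope caveats): the Hoeffding step (`N = Θ(log(1/δ)/ε²)` repetitions estimate all
`|Tr(Pρ)|²` to `±ε`: HKP Lemma 3 / Huang et al. Lemma 1), the sign-estimation stage with quantum
memory, the lower bounds for single-copy (conventional) strategies (`Ω(2ⁿ)`), Montanaro's
stabilizer-learning algorithm, and anything about a device.

(pub-qadeq lane context — CLAIMS rows E-53 (Liu et al., Science 389 (2025): the continuous-variable
descendant of the Huang et al. 2022 two-copy protocol), E-54 (Seif et al. 2026: the Bell probe with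
memory, tree file `PauliChannelEstimation.lean`), and the harvest-1 theory row A-34 (joint Bell
measurements on two copies estimate any post hoc Pauli functional): this file is the tree
vocabulary for WHY one Bell-basis measurement on `ρ ⊗ ρ` fixes `|Tr(Pρ)|` for all `4ⁿ` Pauli
strings `P` at once — the Bell basis is a common eigenbasis of every `P ⊗ P`.  It formalizes no
sample-complexity bound and no separation.  HONEST FRAMING: instance-level adjudication of
specific advantage claims; no claim about BQP vs BPP or the summit — this file is
finite-dimensional linear algebra and says nothing about any experiment.)

## References

* H.-Y. Huang, R. Kueng, J. Preskill, *Information-theoretic bounds on quantum advantage in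
  machine learning*, Phys. Rev. Lett. **126**, 190505 (2021), arXiv:2101.02464 — SM, section
  *Exponential separation for predicting expectation values of Pauli operators*, subsection
  *Measuring absolute values* (Bell basis `|Ψ^±⟩, |Φ^±⟩ = (I ⊗ σ)|Ω⟩`; the displayed equations for
  `Prob(±)` and `E[∏_k Tr((σ_k⊗σ_k)S_k)] = |Tr(Pρ)|²`; Lemma 3).  [HuangKuengPreskill2021]
* H.-Y. Huang, M. Broughton, J. Cotler, S. Chen, J. Li, M. Mohseni, H. Neven, R. Babbush,
  R. Kueng, J. Preskill, J. R. McClean, *Quantum advantage in learning from experiments*, Science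
  **376**, 1182–1186 (2022), arXiv:2112.00778 — SM, *A constant upper bound for quantum-enhanced
  experiments* (Learning phase / Prediction phase, eq. (bell-expected), Lemma 1).  [HuangEtAl2022Science]
* A. Montanaro, *Learning stabilizer states by Bell sampling*, arXiv:1707.04012 (2017) — §2
  (the Bell basis `|σ_s⟩ = vec(σ_s)/√2ⁿ`) and Lemma 2.  [Montanaro2017BellSampling]
* I. Bengtsson, K. Życzkowski, *Geometry of Quantum States*, 2nd ed., CUP (2017) — eq. (16.20)
  `U ⊗ V|Γ⟩ = |UΓVᵀ⟩` and (16.21) (the maximally entangled state `|φ⁺⟩ = |𝟙⟩/√N`).  [BengtssonZyczkowski2017]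
* Tree: `PauliChannelEstimation.lean` (`bellState`, `bellState_apply`, `bellBasis_eq`,
  `trace_bellBasis`, `sum_bellBasis`), `PauliExpansion.lean` / `PauliParseval.lean` (`Pauli.mat`,
  `tensorAll`, `pauliString_mul_self`, `conjTranspose_pauliString`), `OutOfTimeOrderCorrelator.lean`
  (`pauliString_mul_comm_smul`, `strSign_mul_self`, `strSign_eq_one_or`); Mathlib `Matrix.kronecker`
  (`mul_kronecker_mul`, `trace_kronecker`, `one_kronecker_one`, `smul_kronecker`).
-/

noncomputable section

open Matrix Finset
open scoped Kronecker

namespace Literature.InformationTheory.QuantumLearning.BellSampling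

open Literature.Computability.QuantumComplexity
open Literature.Computability.QuantumComplexity.PauliPath
open Literature.Computability.QuantumComplexity.OTOC
open Literature.InformationTheory.QuantumLearning.PauliChannelEstimation

variable {ι : Type*} [Fintype ι] [DecidableEq ι]

/-! ### Transposition of Pauli matrices and Pauli strings -/

omit [Fintype ι] [DecidableEq ι] in
/-- The transposition table of the Pauli matrices: `Iᵀ = I`, `Xᵀ = X`, `Zᵀ = Z`, `Yᵀ = −Y`
(`Y = [[0,−i],[i,0]]` is the only antisymmetric one). [cite: Montanaro2017BellSampling, §2 ("σ_11 := σ_10σ_01 = [[0,1],[−1,0]] … the Pauli matrices up to applying −i to σ_11")] -/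
theorem transpose_pauliMat (Q : Pauli) :
    (Pauli.mat Q)ᵀ = (if Q = Pauli.Y then (-1 : ℂ) else 1) • Pauli.mat Q := by
  ext a b
  cases Q <;> cases a <;> cases b <;> simp [Matrix.transpose_apply]

/-- The **transposition sign** of a Pauli string, `ySign S = (−1)^{#{i : S_i = Y}}`: the scalar with
`P_Sᵀ = ySign S · P_S` (equivalently `P̄_S = ySign S · P_S`, complex conjugation in the
computational basis — the `|ψ*⟩` of Montanaro's Lemma 2). [cite: Montanaro2017BellSampling, §2 and Lemma 2] -/
def ySign (S : ι → Pauli) : ℂ :=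
  ∏ i, (if S i = Pauli.Y then (-1 : ℂ) else 1)

omit [DecidableEq ι] in
/-- Unfolding of `ySign`. [cite: Montanaro2017BellSampling, §2] -/
theorem ySign_eq (S : ι → Pauli) : ySign S = ∏ i, (if S i = Pauli.Y then (-1 : ℂ) else 1) := rfl

omit [DecidableEq ι] in
/-- `ySign S ∈ {±1}`: `ySign S · ySign S = 1`. [cite: Montanaro2017BellSampling, §2] -/
theorem ySign_mul_self (S : ι → Pauli) : ySign S * ySign S = 1 := by
  rw [ySign_eq, ← Finset.prod_mul_distrib]
  exact Finset.prod_eq_one fun i _ => by split_ifs <;> norm_num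

omit [DecidableEq ι] in
/-- `ySign S = 1 ∨ ySign S = −1`. [cite: Montanaro2017BellSampling, §2] -/
theorem ySign_eq_one_or (S : ι → Pauli) : ySign S = 1 ∨ ySign S = -1 :=
  mul_self_eq_one_iff.1 (ySign_mul_self S)

omit [DecidableEq ι] in
/-- The identity string has transposition sign `1`. [cite: Montanaro2017BellSampling, §2] -/
theorem ySign_const_I : ySign (fun _ : ι => Pauli.I) = 1 := by
  rw [ySign_eq]
  exact Finset.prod_eq_one fun i _ => by simp

omit [DecidableEq ι] in
/-- `(⊗ Aᵢ)ᵀ = ⊗ Aᵢᵀ`. [folklore] -/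
private theorem transpose_tensorAll (A : ι → Matrix Bool Bool ℂ) :
    (tensorAll A)ᵀ = tensorAll fun i => (A i)ᵀ := by
  ext x y
  simp [Matrix.transpose_apply, tensorAll_apply]

omit [DecidableEq ι] in
/-- Scalars pull out of every tensor factor: `⊗ (cᵢ Aᵢ) = (∏ cᵢ) ⊗ Aᵢ`. [folklore] -/
private theorem tensorAll_smul (c : ι → ℂ) (A : ι → Matrix Bool Bool ℂ) :
    tensorAll (fun i => c i • A i) = (∏ i, c i) • tensorAll A := by
  ext x y
  simp only [tensorAll_apply, Matrix.smul_apply, smul_eq_mul]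
  rw [Finset.prod_mul_distrib]

omit [DecidableEq ι] in
/-- **Transposition of a Pauli string**: `P_Sᵀ = ySign S · P_S`. [cite: Montanaro2017BellSampling, §2 and Lemma 2 (the complex conjugate |ψ*⟩)] -/
theorem transpose_pauliString (S : ι → Pauli) :
    (pauliString S)ᵀ = ySign S • pauliString S := by
  rw [pauliString_eq, transpose_tensorAll]
  have h : (fun i => ((S i).mat)ᵀ) = fun i => (if S i = Pauli.Y then (-1 : ℂ) else 1) • (S i).mat :=
    funext fun i => transpose_pauliMat (S i)
  rw [h, tensorAll_smul, ySign_eq]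

/-- `P_S P_Sᵀ = ySign S · 1`. [cite: Montanaro2017BellSampling, §2] -/
theorem pauliString_mul_transpose_self (S : ι → Pauli) :
    pauliString S * (pauliString S)ᵀ = ySign S • (1 : Matrix (ι → Bool) (ι → Bool) ℂ) := by
  rw [transpose_pauliString, Matrix.mul_smul, pauliString_mul_self]

/-! ### The Bell state against product operators -/

/-- Summing a doubled index against two Kronecker deltas. [folklore] -/
private theorem sum_prod_ite_ite {α : Type*} [Fintype α] [DecidableEq α] (a : α) (g : α → α → ℂ) :
    ∑ z : α × α, (if z.1 = z.2 then (if a = z.2 then g z.1 z.2 else 0) else 0) = g a a := by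
  rw [Fintype.sum_prod_type]
  simp only [Finset.sum_ite_eq, Finset.mem_univ, if_true]

/-- **The ricochet property of the Bell state** (transpose trick): `(A ⊗ 1)Φ⁺ = (1 ⊗ Aᵀ)Φ⁺` — a local
operator on the system half of `n` Bell pairs acts as its transpose on the memory half
(`U ⊗ V|Γ⟩ = |UΓVᵀ⟩` with `Γ = 𝟙`). [cite: BengtssonZyczkowski2017, eq. (16.20)–(16.21)] -/
theorem kronecker_one_mul_bellState (A : Matrix (ι → Bool) (ι → Bool) ℂ) :
    (A ⊗ₖ (1 : Matrix (ι → Bool) (ι → Bool) ℂ)) * bellState =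
      ((1 : Matrix (ι → Bool) (ι → Bool) ℂ) ⊗ₖ Aᵀ) * bellState := by
  set c : ℂ := (((2 : ℂ) ^ Fintype.card ι)⁻¹) with hc
  have lhs : ∀ x y : (ι → Bool) × (ι → Bool),
      ((A ⊗ₖ (1 : Matrix (ι → Bool) (ι → Bool) ℂ)) * (bellState : Matrix ((ι → Bool) × (ι → Bool)) ((ι → Bool) × (ι → Bool)) ℂ)) x y =
        if y.1 = y.2 then A x.1 x.2 * c else 0 := by
    intro x y
    rw [Matrix.mul_apply]
    have hterm : ∀ z : (ι → Bool) × (ι → Bool),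
        (A ⊗ₖ (1 : Matrix (ι → Bool) (ι → Bool) ℂ)) x z * (bellState : Matrix ((ι → Bool) × (ι → Bool)) ((ι → Bool) × (ι → Bool)) ℂ) z y =
          if z.1 = z.2 then (if x.2 = z.2 then (if y.1 = y.2 then A x.1 z.1 * c else 0) else 0)
            else 0 := by
      intro z
      rw [Matrix.kroneckerMap_apply, bellState_apply, Matrix.one_apply, ← hc]
      by_cases h1 : z.1 = z.2 <;> by_cases h2 : x.2 = z.2 <;> by_cases h3 : y.1 = y.2 <;>
        simp [h1, h2, h3]
    simp only [hterm]
    rw [sum_prod_ite_ite x.2 (fun a _ => if y.1 = y.2 then A x.1 a * c else 0)]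
  have rhs : ∀ x y : (ι → Bool) × (ι → Bool),
      (((1 : Matrix (ι → Bool) (ι → Bool) ℂ) ⊗ₖ Aᵀ) * (bellState : Matrix ((ι → Bool) × (ι → Bool)) ((ι → Bool) × (ι → Bool)) ℂ)) x y =
        if y.1 = y.2 then A x.1 x.2 * c else 0 := by
    intro x y
    rw [Matrix.mul_apply]
    have hterm : ∀ z : (ι → Bool) × (ι → Bool),
        (((1 : Matrix (ι → Bool) (ι → Bool) ℂ) ⊗ₖ Aᵀ)) x z * (bellState : Matrix ((ι → Bool) × (ι → Bool)) ((ι → Bool) × (ι → Bool)) ℂ) z y =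
          if z.1 = z.2 then (if x.1 = z.2 then (if y.1 = y.2 then A z.2 x.2 * c else 0) else 0)
            else 0 := by
      intro z
      rw [Matrix.kroneckerMap_apply, bellState_apply, Matrix.one_apply, Matrix.transpose_apply, ← hc]
      by_cases h1 : z.1 = z.2 <;> by_cases h2 : x.1 = z.2 <;> by_cases h3 : y.1 = y.2 <;>
        simp [h1, h2, h3]
    simp only [hterm]
    rw [sum_prod_ite_ite x.1 (fun _ b => if y.1 = y.2 then A b x.2 * c else 0)]
  ext x y
  rw [lhs, rhs]

/-- The same on the right: `Φ⁺(A ⊗ 1) = Φ⁺(1 ⊗ Aᵀ)`. [cite: BengtssonZyczkowski2017, eq. (16.20)–(16.21)] -/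
theorem bellState_mul_kronecker_one (A : Matrix (ι → Bool) (ι → Bool) ℂ) :
    bellState * (A ⊗ₖ (1 : Matrix (ι → Bool) (ι → Bool) ℂ)) =
      bellState * ((1 : Matrix (ι → Bool) (ι → Bool) ℂ) ⊗ₖ Aᵀ) := by
  have hΦ : (bellState : Matrix ((ι → Bool) × (ι → Bool)) _ ℂ)ᴴ = bellState := by
    ext x y
    rw [Matrix.conjTranspose_apply, bellState_apply, bellState_apply]
    by_cases h : y.1 = y.2 ∧ x.1 = x.2
    · rw [if_pos h, if_pos (And.intro h.2 h.1)]
      simp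
    · rw [if_neg h, if_neg (fun h' => h (And.intro h'.2 h'.1)), star_zero]
  have key := kronecker_one_mul_bellState (ι := ι) Aᴴ
  have h1 : ((Aᴴ ⊗ₖ (1 : Matrix (ι → Bool) (ι → Bool) ℂ)) * bellState)ᴴ =
      bellState * (A ⊗ₖ (1 : Matrix (ι → Bool) (ι → Bool) ℂ)) := by
    rw [Matrix.conjTranspose_mul, hΦ, Matrix.conjTranspose_kronecker, Matrix.conjTranspose_conjTranspose,
      Matrix.conjTranspose_one]
  have h2 : ((((1 : Matrix (ι → Bool) (ι → Bool) ℂ)) ⊗ₖ (Aᴴ)ᵀ) * bellState)ᴴ =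
      bellState * ((1 : Matrix (ι → Bool) (ι → Bool) ℂ) ⊗ₖ Aᵀ) := by
    rw [Matrix.conjTranspose_mul, hΦ, Matrix.conjTranspose_kronecker, Matrix.conjTranspose_one]
    congr 2
    ext i j
    simp [Matrix.conjTranspose_apply, Matrix.transpose_apply]
  rw [← h1, key, h2]

/-- **Read-out of a product operator against the Bell state**: `Tr(Φ⁺ (A ⊗ B)) = 2^{−n} Tr(A Bᵀ)`
(`⟨Φ⁺|A ⊗ B|Φ⁺⟩ = Tr(ABᵀ)/2ⁿ`). [cite: Montanaro2017BellSampling, §2 ("⟨vec(A)|vec(B)⟩ = tr A†B") and Lemma 2 (proof)] -/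
theorem trace_bellState_mul_kronecker (A B : Matrix (ι → Bool) (ι → Bool) ℂ) :
    (bellState * (A ⊗ₖ B)).trace = (((2 : ℂ) ^ Fintype.card ι)⁻¹) * (A * Bᵀ).trace := by
  set c : ℂ := (((2 : ℂ) ^ Fintype.card ι)⁻¹) with hc
  simp only [Matrix.trace, Matrix.diag_apply, Matrix.mul_apply]
  have hterm : ∀ x y : (ι → Bool) × (ι → Bool),
      (bellState : Matrix ((ι → Bool) × (ι → Bool)) ((ι → Bool) × (ι → Bool)) ℂ) x y * (A ⊗ₖ B) y x =
        if x.1 = x.2 then (if y.1 = y.2 then c * (A y.1 x.1 * B y.2 x.2) else 0) else 0 := by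
    intro x y
    rw [bellState_apply, Matrix.kroneckerMap_apply, ← hc]
    by_cases h1 : x.1 = x.2 <;> by_cases h2 : y.1 = y.2 <;> simp [h1, h2]
  simp only [hterm]
  have inner : ∀ x : (ι → Bool) × (ι → Bool),
      ∑ y : (ι → Bool) × (ι → Bool),
          (if x.1 = x.2 then (if y.1 = y.2 then c * (A y.1 x.1 * B y.2 x.2) else 0) else 0) =
        if x.1 = x.2 then ∑ a : ι → Bool, c * (A a x.1 * B a x.2) else 0 := by
    intro x
    by_cases h : x.1 = x.2
    · simp only [if_pos h]
      rw [Fintype.sum_prod_type]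
      simp only [Finset.sum_ite_eq, Finset.mem_univ, if_true]
    · simp [h]
  simp only [inner]
  rw [Fintype.sum_prod_type]
  simp only [Finset.sum_ite_eq, Finset.mem_univ, if_true, Matrix.transpose_apply]
  rw [Finset.sum_comm, Finset.mul_sum]
  refine Finset.sum_congr rfl fun a _ => ?_
  rw [Finset.mul_sum]

/-! ### The Bell-sampling outcome distribution (Montanaro's Lemma 2) -/

/-- **Bell sampling on `ρ ⊗ σ`** (Montanaro's Lemma 2 in density-matrix form): the weight of the
Bell-basis outcome `b` is `Tr(Φ_b (ρ ⊗ σ)) = 2^{−n} Tr(P_b ρ P_b σᵀ)`; for `ρ = σ = |ψ⟩⟨ψ|` the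
right-hand side is `|⟨ψ|P_b|ψ*⟩|²/2ⁿ`, `|ψ*⟩` the complex conjugate in the computational basis.
[cite: Montanaro2017BellSampling, Lemma 2] -/
theorem trace_bellBasis_mul_kronecker (T : ι → Pauli) (ρ σ : Matrix (ι → Bool) (ι → Bool) ℂ) :
    (bellBasis T * (ρ ⊗ₖ σ)).trace =
      (((2 : ℂ) ^ Fintype.card ι)⁻¹) * (pauliString T * ρ * pauliString T * σᵀ).trace := by
  rw [bellBasis_eq, Matrix.mul_assoc _ _ (ρ ⊗ₖ σ), Matrix.mul_assoc, Matrix.trace_mul_comm,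
    Matrix.mul_assoc, ← Matrix.mul_kronecker_mul, ← Matrix.mul_kronecker_mul, Matrix.one_mul,
    Matrix.mul_one, trace_bellState_mul_kronecker]

/-- **Montanaro's Lemma 2, as printed (pure states)**: Bell sampling on `|ψ⟩ ⊗ |ψ⟩` returns the
outcome `b` with probability `|⟨ψ|P_b|ψ*⟩|²/2ⁿ`; here `|ψ⟩⟨ψ| = vecMulVec ψ (star ψ)` and
`⟨ψ|P_b|ψ*⟩ = Σ_{k,l} ψ̄_k (P_b)_{kl} ψ̄_l = star ψ ⬝ᵥ (P_b *ᵥ star ψ)` (`|ψ*⟩` the complex conjugate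
in the computational basis). [cite: Montanaro2017BellSampling, Lemma 2] -/
theorem trace_bellBasis_mul_kronecker_pure (T : ι → Pauli) (ψ : (ι → Bool) → ℂ) :
    (bellBasis T * (vecMulVec ψ (star ψ) ⊗ₖ vecMulVec ψ (star ψ))).trace =
      (((2 : ℂ) ^ Fintype.card ι)⁻¹) *
        ((‖star ψ ⬝ᵥ (pauliString T *ᵥ star ψ)‖ ^ 2 : ℝ) : ℂ) := by
  rw [trace_bellBasis_mul_kronecker, Matrix.transpose_vecMulVec,
    Matrix.mul_vecMulVec (pauliString T) ψ (star ψ), Matrix.vecMulVec_mul,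
    Matrix.vecMulVec_mul_vecMulVec, Matrix.trace_vecMulVec, dotProduct_smul, smul_eq_mul]
  congr 1
  set c : ℂ := star ψ ⬝ᵥ (pauliString T *ᵥ star ψ) with hc
  have h1 : (star ψ ᵥ* pauliString T) ⬝ᵥ star ψ = c := by
    rw [hc, Matrix.dotProduct_mulVec]
  have h2 : (pauliString T *ᵥ ψ) ⬝ᵥ ψ = star c := by
    rw [← h1, ← star_dotProduct_star, star_star, Matrix.star_vecMul, conjTranspose_pauliString,
      star_star, dotProduct_comm]
  rw [h1, h2, ← starRingEnd_apply, Complex.mul_conj, Complex.normSq_eq_norm_sq]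

/-- The Bell-sampling weights of `ρ ⊗ σ` sum to `Tr ρ · Tr σ` (`= 1` for states): completeness of
the Bell basis. [cite: Montanaro2017BellSampling, §2 (the Bell basis is an ordered basis of (ℂ⁴)^{⊗n})] -/
theorem sum_trace_bellBasis_mul (X : Matrix ((ι → Bool) × (ι → Bool)) ((ι → Bool) × (ι → Bool)) ℂ) :
    ∑ T : ι → Pauli, (bellBasis T * X).trace = X.trace := by
  rw [← Matrix.trace_sum, ← Finset.sum_mul, sum_bellBasis, Matrix.one_mul]

/-- In particular `Σ_b Tr(Φ_b(ρ ⊗ σ)) = Tr ρ · Tr σ`. [cite: Montanaro2017BellSampling, Lemma 2] -/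
theorem sum_trace_bellBasis_mul_kronecker (ρ σ : Matrix (ι → Bool) (ι → Bool) ℂ) :
    ∑ T : ι → Pauli, (bellBasis T * (ρ ⊗ₖ σ)).trace = ρ.trace * σ.trace := by
  rw [sum_trace_bellBasis_mul, Matrix.trace_kronecker]

/-! ### Every Bell state is a `±1` eigenstate of every `P ⊗ P` -/

/-- `Φ⁺` is an eigenstate of `P_a ⊗ P_a` with eigenvalue `ySign a = (−1)^{#Y(a)}`:
`(P_a ⊗ P_a)Φ⁺ = (P_a P_aᵀ ⊗ 1)Φ⁺ = ySign a · Φ⁺` (`X⊗X` and `Z⊗Z` fix `|Ω⟩ = (|00⟩+|11⟩)/√2`,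
`Y⊗Y` flips its sign). [cite: HuangKuengPreskill2021, SM §'Measuring absolute values' ("each Bell state is an eigenstate of σ⊗σ with eigenvalue ±1")] -/
theorem kronecker_self_mul_bellState (S : ι → Pauli) :
    (pauliString S ⊗ₖ pauliString S) * bellState = ySign S • (bellState : Matrix _ _ ℂ) := by
  have h1 : pauliString S ⊗ₖ pauliString S =
      (pauliString S ⊗ₖ (1 : Matrix (ι → Bool) (ι → Bool) ℂ)) *
        ((1 : Matrix (ι → Bool) (ι → Bool) ℂ) ⊗ₖ pauliString S) := by
    rw [← Matrix.mul_kronecker_mul, Matrix.mul_one, Matrix.one_mul]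
  have h2 : ((1 : Matrix (ι → Bool) (ι → Bool) ℂ) ⊗ₖ pauliString S) * bellState =
      ((pauliString S)ᵀ ⊗ₖ (1 : Matrix (ι → Bool) (ι → Bool) ℂ)) * bellState := by
    rw [kronecker_one_mul_bellState, Matrix.transpose_transpose]
  rw [h1, Matrix.mul_assoc, h2, ← Matrix.mul_assoc, ← Matrix.mul_kronecker_mul, Matrix.one_mul,
    pauliString_mul_transpose_self, Matrix.smul_kronecker, Matrix.one_kronecker_one, Matrix.smul_mul,
    Matrix.one_mul]

/-- **Each Bell state `Φ_b` is an eigenstate of `P_a ⊗ P_a`**, with eigenvalue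
`ε(a,b) = ySign a · (−1)^{⟨a,b⟩}` (`(−1)^{⟨a,b⟩} = strSign a b`, the commutation character of the
tree): `(P_a ⊗ P_a)Φ_b = ε(a,b) · Φ_b`. [cite: HuangKuengPreskill2021, SM §'Measuring absolute values' ("S_k is an eigenstate of σ_k⊗σ_k with eigenvalue ±1 … ⊗_k S_k is an eigenstate of P⊗P")]
[cite: HuangEtAl2022Science, SM §'Prediction phase'] -/
theorem kronecker_self_mul_bellBasis (S T : ι → Pauli) :
    (pauliString S ⊗ₖ pauliString S) * bellBasis T = (ySign S * strSign S T) • bellBasis T := by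
  have hc : (pauliString S ⊗ₖ pauliString S) * (pauliString T ⊗ₖ (1 : Matrix (ι → Bool) (ι → Bool) ℂ)) =
      strSign S T • ((pauliString T ⊗ₖ (1 : Matrix (ι → Bool) (ι → Bool) ℂ)) *
        (pauliString S ⊗ₖ pauliString S)) := by
    rw [← Matrix.mul_kronecker_mul, ← Matrix.mul_kronecker_mul, pauliString_mul_comm_smul S T,
      Matrix.smul_kronecker, Matrix.mul_one, Matrix.one_mul]
  rw [bellBasis_eq, ← Matrix.mul_assoc, ← Matrix.mul_assoc, hc, Matrix.smul_mul, Matrix.smul_mul,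
    Matrix.mul_assoc _ _ bellState, kronecker_self_mul_bellState, Matrix.mul_smul, Matrix.smul_mul,
    smul_smul, mul_comm (strSign S T)]

omit [DecidableEq ι] in
/-- The eigenvalue is `±1`: `ε(a,b)·ε(a,b) = 1`. [cite: HuangKuengPreskill2021, SM §'Measuring absolute values' ("∏_k Tr((σ_k⊗σ_k)S_k) = ±1")] -/
theorem bellSign_mul_self (S T : ι → Pauli) :
    (ySign S * strSign S T) * (ySign S * strSign S T) = 1 := by
  calc (ySign S * strSign S T) * (ySign S * strSign S T)
      = (ySign S * ySign S) * (strSign S T * strSign S T) := by ring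
    _ = 1 := by rw [ySign_mul_self, strSign_mul_self, mul_one]

omit [DecidableEq ι] in
/-- `ε(a,b) = 1 ∨ ε(a,b) = −1`. [cite: HuangKuengPreskill2021, SM §'Measuring absolute values'] -/
theorem bellSign_eq_one_or (S T : ι → Pauli) :
    ySign S * strSign S T = 1 ∨ ySign S * strSign S T = -1 :=
  mul_self_eq_one_iff.1 (bellSign_mul_self S T)

/-- **`Tr((P_a ⊗ P_a)Φ_b) = ε(a,b) = ±1`** — the printed "`∏_k Tr((σ_k ⊗ σ_k)S_k) = ±1`" for the
Bell-measurement outcome `⊗_k S_k = Φ_b`. [cite: HuangKuengPreskill2021, SM §'Measuring absolute values'] [cite: HuangEtAl2022Science, SM §'Prediction phase'] -/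
theorem trace_kronecker_self_mul_bellBasis (S T : ι → Pauli) :
    ((pauliString S ⊗ₖ pauliString S) * bellBasis T).trace = ySign S * strSign S T := by
  rw [kronecker_self_mul_bellBasis, Matrix.trace_smul, trace_bellBasis, smul_eq_mul, mul_one]

/-- **Spectral decomposition of `P ⊗ P` in the Bell basis**: `P_a ⊗ P_a = Σ_b ε(a,b) Φ_b` — the `4ⁿ`
Bell states are a common eigenbasis of all `P_a ⊗ P_a`, which is why ONE Bell-basis measurement
measures every `P ⊗ P` simultaneously. [cite: HuangKuengPreskill2021, SM §'Measuring absolute values' ("two-copy Bell basis measurements … to simultaneously measure X⊗X, Y⊗Y, Z⊗Z on each of the n qubits")] -/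
theorem kronecker_self_eq_sum_bellBasis (S : ι → Pauli) :
    pauliString S ⊗ₖ pauliString S = ∑ T : ι → Pauli, (ySign S * strSign S T) • bellBasis T := by
  calc pauliString S ⊗ₖ pauliString S
      = (pauliString S ⊗ₖ pauliString S) * ∑ T : ι → Pauli, bellBasis T := by
        rw [sum_bellBasis, Matrix.mul_one]
    _ = ∑ T : ι → Pauli, (pauliString S ⊗ₖ pauliString S) * bellBasis T := by rw [Matrix.mul_sum]
    _ = ∑ T : ι → Pauli, (ySign S * strSign S T) • bellBasis T :=
        Finset.sum_congr rfl fun T _ => kronecker_self_mul_bellBasis S T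

/-! ### The identity (bell-expected): `|Tr(Pρ)|²` from the Bell-measurement distribution -/

/-- **`E[Tr((P⊗P)S)] = Tr((P⊗P)X)`**: for every operator `X` on the doubled register (the state
that is Bell-measured), the `±1`-valued statistic `b ↦ ε(a,b)` averaged against the outcome weights
`Tr(Φ_b X)` is `Tr((P_a ⊗ P_a)X) = Prob(P⊗P = +1) − Prob(P⊗P = −1)`. [cite: HuangKuengPreskill2021, SM §'Measuring absolute values' (E[∏_k Tr((σ_k⊗σ_k)S_k)] = E[Tr((P⊗P)⊗_k S_k)] = Prob(+) − Prob(−))]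
[cite: HuangEtAl2022Science, SM §'Prediction phase', eq. (bell-expected)] -/
theorem sum_bellSign_mul_trace_bellBasis_mul (S : ι → Pauli)
    (X : Matrix ((ι → Bool) × (ι → Bool)) ((ι → Bool) × (ι → Bool)) ℂ) :
    ∑ T : ι → Pauli, (ySign S * strSign S T) * (bellBasis T * X).trace =
      ((pauliString S ⊗ₖ pauliString S) * X).trace := by
  rw [kronecker_self_eq_sum_bellBasis, Finset.sum_mul, Matrix.trace_sum]
  refine Finset.sum_congr rfl fun T _ => ?_
  rw [Matrix.smul_mul, Matrix.trace_smul, smul_eq_mul]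

/-- `Tr((P_a ⊗ P_a)(ρ ⊗ σ)) = Tr(P_a ρ) · Tr(P_a σ)`. [cite: HuangKuengPreskill2021, SM §'Measuring absolute values' (Tr((P⊗P)(ρ⊗ρ)) = |Tr(Pρ)|²)] -/
theorem trace_kronecker_self_mul_kronecker (S : ι → Pauli) (ρ σ : Matrix (ι → Bool) (ι → Bool) ℂ) :
    ((pauliString S ⊗ₖ pauliString S) * (ρ ⊗ₖ σ)).trace =
      (pauliString S * ρ).trace * (pauliString S * σ).trace := by
  rw [← Matrix.mul_kronecker_mul, Matrix.trace_kronecker]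

/-- **The two-copy identity (bell-expected)**: Bell-measuring `ρ ⊗ ρ`,
`Σ_b ε(a,b) · Tr(Φ_b(ρ ⊗ ρ)) = Tr((P_a ⊗ P_a)(ρ ⊗ ρ)) = Tr(P_a ρ)²` for EVERY Pauli string `a` —
one outcome distribution determines all `4ⁿ` squared Pauli expectation values.
[cite: HuangKuengPreskill2021, SM §'Measuring absolute values'] [cite: HuangEtAl2022Science, SM §'Prediction phase', eq. (bell-expected)] -/
theorem sum_bellSign_mul_trace_bellBasis_two_copies (S : ι → Pauli)
    (ρ : Matrix (ι → Bool) (ι → Bool) ℂ) :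
    ∑ T : ι → Pauli, (ySign S * strSign S T) * (bellBasis T * (ρ ⊗ₖ ρ)).trace =
      (pauliString S * ρ).trace ^ 2 := by
  rw [sum_bellSign_mul_trace_bellBasis_mul, trace_kronecker_self_mul_kronecker, sq]

/-- For a Hermitian `ρ` the Pauli expectation `Tr(P_a ρ)` is real. [cite: HuangKuengPreskill2021, SM §'Measuring absolute values' (|Tr(Pρ)|²)] -/
theorem star_trace_pauliString_mul {ρ : Matrix (ι → Bool) (ι → Bool) ℂ} (hρ : ρᴴ = ρ) (S : ι → Pauli) :
    star (pauliString S * ρ).trace = (pauliString S * ρ).trace := by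
  rw [← Matrix.trace_conjTranspose, Matrix.conjTranspose_mul, hρ, conjTranspose_pauliString,
    Matrix.trace_mul_comm]

/-- **`Σ_b ε(a,b) Tr(Φ_b(ρ⊗ρ)) = |Tr(P_a ρ)|²`** for Hermitian `ρ` — the printed right-hand side.
[cite: HuangKuengPreskill2021, SM §'Measuring absolute values'] [cite: HuangEtAl2022Science, SM §'Prediction phase', eq. (bell-expected)] -/
theorem sum_bellSign_mul_trace_bellBasis_two_copies_eq_norm_sq (S : ι → Pauli)
    {ρ : Matrix (ι → Bool) (ι → Bool) ℂ} (hρ : ρᴴ = ρ) :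
    ∑ T : ι → Pauli, (ySign S * strSign S T) * (bellBasis T * (ρ ⊗ₖ ρ)).trace =
      ((‖(pauliString S * ρ).trace‖ ^ 2 : ℝ) : ℂ) := by
  rw [sum_bellSign_mul_trace_bellBasis_two_copies, sq]
  set z : ℂ := (pauliString S * ρ).trace with hz
  have hreal : (starRingEnd ℂ) z = z := star_trace_pauliString_mul hρ S
  calc z * z = z * (starRingEnd ℂ) z := by rw [hreal]
    _ = ((Complex.normSq z : ℝ) : ℂ) := Complex.mul_conj z
    _ = ((‖z‖ ^ 2 : ℝ) : ℂ) := by rw [Complex.normSq_eq_norm_sq]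

/-- **The two half-sums `Prob(±)`**: the total weight of the outcomes `b` with `ε(a,b) = +1` is
`½ Tr((1 + P_a ⊗ P_a) X)`, and with `ε(a,b) = −1` it is `½ Tr((1 − P_a ⊗ P_a) X)`.
[cite: HuangKuengPreskill2021, SM §'Measuring absolute values' (Prob(+) = ½Tr((I⊗I + σ⊗σ)(ρ⊗ρ)), Prob(−) = ½Tr((I⊗I − σ⊗σ)(ρ⊗ρ)))]
[cite: HuangEtAl2022Science, SM §'Prediction phase'] -/
theorem sum_trace_bellBasis_mul_filter_sign_eq (S : ι → Pauli)
    (X : Matrix ((ι → Bool) × (ι → Bool)) ((ι → Bool) × (ι → Bool)) ℂ) (s : ℂ) (hs : s = 1 ∨ s = -1) :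
    ∑ T ∈ Finset.univ.filter (fun T : ι → Pauli => ySign S * strSign S T = s),
        (bellBasis T * X).trace =
      (1 / 2 : ℂ) * ((1 + s • (pauliString S ⊗ₖ pauliString S)) * X).trace := by
  -- `[ε = s] = (1 + s ε)/2` for `ε, s ∈ {±1}`
  have hind : ∀ T : ι → Pauli,
      (if ySign S * strSign S T = s then (bellBasis T * X).trace else 0) =
        (1 / 2 : ℂ) * ((1 + s * (ySign S * strSign S T)) * (bellBasis T * X).trace) := by
    intro T
    rcases bellSign_eq_one_or S T with h | h <;> rcases hs with rfl | rfl <;> rw [h] <;> norm_num <;> ring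
  rw [Finset.sum_filter]
  simp only [hind]
  rw [← Finset.mul_sum]
  congr 1
  simp only [add_mul, one_mul, Finset.sum_add_distrib]
  rw [sum_trace_bellBasis_mul, Matrix.trace_add, Matrix.smul_mul, Matrix.trace_smul, smul_eq_mul,
    ← sum_bellSign_mul_trace_bellBasis_mul, Finset.mul_sum]
  congr 1
  refine Finset.sum_congr rfl fun T _ => ?_
  ring


/-! ### (v2) The printed per-qubit product `∏_k Tr((σ_k ⊗ σ_k) S_k)` and the one-qubit table -/

/-- The **one-qubit Bell sign** `e(σ, τ) ∈ {±1}`: the eigenvalue of `σ ⊗ σ` on the one-qubit Bell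
projector `Φ_τ = (τ ⊗ 1)|Ω⟩⟨Ω|(τ ⊗ 1)` — `e(σ, τ) = (−1)^{[σ = Y]} · sign(σ, τ)` (transposition sign
times commutation sign). [cite: HuangKuengPreskill2021, SM §'Measuring absolute values' ("each Bell state is an eigenstate of σ⊗σ with eigenvalue ±1 … Tr((σ_k⊗σ_k)S_k)")] -/
def bellSign₁ (σ τ : Pauli) : ℂ :=
  (if σ = Pauli.Y then (-1 : ℂ) else 1) * Pauli.sign σ τ

omit [DecidableEq ι] in
/-- **`ε(a,b)` factorises over the qubits**: `ySign a · (−1)^{⟨a,b⟩} = ∏_k e(a_k, b_k)` — the printed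
`Tr((P⊗P) ⊗_k S_k) = ∏_k Tr((σ_k ⊗ σ_k) S_k)`. [cite: HuangKuengPreskill2021, SM §'Measuring absolute values' (E[∏_k Tr((σ_k⊗σ_k)S_k)] = E[Tr((P⊗P)⊗_k S_k)])]
[cite: HuangEtAl2022Science, SM §'Prediction phase'] -/
theorem bellSign_eq_prod (S T : ι → Pauli) :
    ySign S * strSign S T = ∏ i, bellSign₁ (S i) (T i) := by
  rw [ySign_eq, strSign_eq, ← Finset.prod_mul_distrib]
  rfl

/-- `Tr((P_a ⊗ P_a)Φ_b) = ∏_k e(a_k, b_k)`. [cite: HuangKuengPreskill2021, SM §'Measuring absolute values'] -/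
theorem trace_kronecker_self_mul_bellBasis_eq_prod (S T : ι → Pauli) :
    ((pauliString S ⊗ₖ pauliString S) * bellBasis T).trace = ∏ i, bellSign₁ (S i) (T i) := by
  rw [trace_kronecker_self_mul_bellBasis, bellSign_eq_prod]

/-- **The one-qubit table.**  In the notation of Huang–Kueng–Preskill / Huang et al. the four Bell
states are `|Ψ⁺⟩ = |Ω⟩ = (|00⟩+|11⟩)/√2`, `|Ψ⁻⟩ = (I⊗Z)|Ω⟩`, `|Φ⁺⟩ = (I⊗X)|Ω⟩`, `|Φ⁻⟩ = i(I⊗Y)|Ω⟩`;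
by the ricochet identity `(1 ⊗ σ)|Ω⟩ = (σᵀ ⊗ 1)|Ω⟩` their projectors are the tree's one-qubit
`Φ_I, Φ_Z, Φ_X, Φ_Y`, and the eigenvalues of `(X⊗X, Y⊗Y, Z⊗Z)` on them are
`Φ_I : (+1, −1, +1)`, `Φ_X : (+1, +1, −1)`, `Φ_Y : (−1, −1, −1)` (the singlet), `Φ_Z : (−1, +1, +1)`;
`I ⊗ I` has eigenvalue `+1` throughout. [cite: HuangKuengPreskill2021, SM §'Sample complexity of a quantum ML algorithm' (the Bell basis |Ψ^±⟩, |Φ^±⟩ in terms of |Ω⟩) and §'Measuring absolute values']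
[cite: HuangEtAl2022Science, SM §'Learning phase' (eq. (Bell-basis-meas)) and §'Prediction phase'] -/
theorem bellSign₁_table :
    (bellSign₁ Pauli.X Pauli.I = 1 ∧ bellSign₁ Pauli.Y Pauli.I = -1 ∧ bellSign₁ Pauli.Z Pauli.I = 1) ∧
    (bellSign₁ Pauli.X Pauli.X = 1 ∧ bellSign₁ Pauli.Y Pauli.X = 1 ∧ bellSign₁ Pauli.Z Pauli.X = -1) ∧
    (bellSign₁ Pauli.X Pauli.Y = -1 ∧ bellSign₁ Pauli.Y Pauli.Y = -1 ∧ bellSign₁ Pauli.Z Pauli.Y = -1) ∧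
    (bellSign₁ Pauli.X Pauli.Z = -1 ∧ bellSign₁ Pauli.Y Pauli.Z = 1 ∧ bellSign₁ Pauli.Z Pauli.Z = 1) ∧
    (∀ τ : Pauli, bellSign₁ Pauli.I τ = 1) := by
  refine ⟨⟨?_, ?_, ?_⟩, ⟨?_, ?_, ?_⟩, ⟨?_, ?_, ?_⟩, ⟨?_, ?_, ?_⟩, fun τ => ?_⟩ <;>
    simp [bellSign₁, Pauli.sign]

/-! ### (v2) The Bell-sampling weights are a probability distribution -/

/-- The amplitude `2^{−n/2}` of the Bell state. [cite: HuangKuengPreskill2021, SM §'Sample complexity of a quantum ML algorithm' ("|Ω⟩ = (|00⟩+|11⟩)/√2")] -/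
def bellAmp (ι : Type*) [Fintype ι] : ℝ := (Real.sqrt ((2 : ℝ) ^ Fintype.card ι))⁻¹

omit [DecidableEq ι] in
/-- `(2^{−n/2})² = 2^{−n}`. [cite: HuangKuengPreskill2021, SM §'Sample complexity of a quantum ML algorithm'] -/
theorem bellAmp_mul_self : (bellAmp ι : ℂ) * bellAmp ι = (((2 : ℂ) ^ Fintype.card ι)⁻¹) := by
  rw [bellAmp, ← Complex.ofReal_mul, ← mul_inv, Real.mul_self_sqrt (by positivity)]
  push_cast
  rfl

omit [DecidableEq ι] in
/-- The **Bell state vector** `|Ω⟩^{⊗n} = 2^{−n/2} Σ_j |j⟩|j⟩` on the doubled register.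
[cite: HuangKuengPreskill2021, SM §'Sample complexity of a quantum ML algorithm' ("|Ω⟩ = (|00⟩+|11⟩)/√2")] [cite: Montanaro2017BellSampling, §2 (|σ_00⟩)] -/
def bellVec : (ι → Bool) × (ι → Bool) → ℂ :=
  fun x => if x.1 = x.2 then (bellAmp ι : ℂ) else 0

omit [DecidableEq ι] in
/-- Unfolding of `bellVec`. [cite: HuangKuengPreskill2021, SM §'Sample complexity of a quantum ML algorithm'] -/
theorem bellVec_apply (x : (ι → Bool) × (ι → Bool)) :
    bellVec x = if x.1 = x.2 then (bellAmp ι : ℂ) else 0 := rfl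

omit [DecidableEq ι] in
/-- **`Φ⁺ = |Ω⟩⟨Ω|`**: the tree's Bell-state density matrix is the rank-one projector onto `bellVec`.
[cite: HuangKuengPreskill2021, SM §'Sample complexity of a quantum ML algorithm'] [cite: Montanaro2017BellSampling, §2] -/
theorem bellState_eq_vecMulVec :
    (bellState : Matrix ((ι → Bool) × (ι → Bool)) ((ι → Bool) × (ι → Bool)) ℂ) =
      vecMulVec bellVec (star bellVec) := by
  ext x y
  rw [bellState_apply, Matrix.vecMulVec_apply, Pi.star_apply, bellVec_apply, bellVec_apply]
  by_cases hx : x.1 = x.2 <;> by_cases hy : y.1 = y.2 <;>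
    simp [hx, hy, Complex.conj_ofReal, ← bellAmp_mul_self]

/-- **`Φ_b = |Φ_b⟩⟨Φ_b|` with `|Φ_b⟩ = (P_b ⊗ 1)|Ω⟩`.** [cite: HuangKuengPreskill2021, SM §'Sample complexity of a quantum ML algorithm' (the Bell basis (I⊗σ)|Ω⟩)] [cite: Montanaro2017BellSampling, §2 (|σ_s⟩ = vec(σ_s)/√2ⁿ)] -/
theorem bellBasis_eq_vecMulVec (T : ι → Pauli) :
    bellBasis T =
      vecMulVec ((pauliString T ⊗ₖ (1 : Matrix (ι → Bool) (ι → Bool) ℂ)) *ᵥ bellVec)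
        (star ((pauliString T ⊗ₖ (1 : Matrix (ι → Bool) (ι → Bool) ℂ)) *ᵥ bellVec)) := by
  rw [bellBasis_eq, bellState_eq_vecMulVec, Matrix.mul_vecMulVec, Matrix.vecMulVec_mul,
    Matrix.star_mulVec, Matrix.conjTranspose_kronecker, conjTranspose_pauliString,
    Matrix.conjTranspose_one]

omit [DecidableEq ι] in
/-- `Tr(|v⟩⟨w| X) = ⟨w|X|v⟩` (`w` entered as the row vector, i.e. `vecMulVec v w`). [folklore] -/
private theorem trace_vecMulVec_mul {α : Type*} [Fintype α] (v w : α → ℂ) (X : Matrix α α ℂ) :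
    (vecMulVec v w * X).trace = w ⬝ᵥ (X *ᵥ v) := by
  rw [Matrix.vecMulVec_mul, Matrix.trace_vecMulVec, Matrix.dotProduct_mulVec, dotProduct_comm]

open scoped ComplexOrder in
/-- **The Bell-measurement weights are nonnegative**: `Tr(Φ_b X) = ⟨Φ_b|X|Φ_b⟩ ≥ 0` for every
positive semidefinite `X` on the doubled register. [cite: Montanaro2017BellSampling, Lemma 2 (a probability)] [cite: HuangKuengPreskill2021, SM §'Measuring absolute values' (Prob(±))] -/
theorem trace_bellBasis_mul_nonneg
    {X : Matrix ((ι → Bool) × (ι → Bool)) ((ι → Bool) × (ι → Bool)) ℂ} (hX : X.PosSemidef)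
    (T : ι → Pauli) : 0 ≤ (bellBasis T * X).trace := by
  rw [bellBasis_eq_vecMulVec, trace_vecMulVec_mul]
  exact hX.dotProduct_mulVec_nonneg _

open scoped ComplexOrder in
/-- … in particular for two states: `Tr(Φ_b (ρ ⊗ σ)) ≥ 0` whenever `ρ, σ ⪰ 0`; with
`sum_trace_bellBasis_mul_kronecker` (`Σ_b = Tr ρ · Tr σ = 1`) the Bell-sampling weights of `ρ ⊗ σ`
are a probability distribution on the `4ⁿ` labels. [cite: Montanaro2017BellSampling, Lemma 2] -/
theorem trace_bellBasis_mul_kronecker_nonneg {ρ σ : Matrix (ι → Bool) (ι → Bool) ℂ}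
    (hρ : ρ.PosSemidef) (hσ : σ.PosSemidef) (T : ι → Pauli) :
    0 ≤ (bellBasis T * (ρ ⊗ₖ σ)).trace :=
  trace_bellBasis_mul_nonneg (hρ.kronecker hσ) T

end Literature.InformationTheory.QuantumLearning.BellSampling
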